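import Summits.Ventures.PercRepro.C041ZonePortCSUnport
import Summits.Ventures.PercRepro.C041ZonePortCSAndDefs

/-!
# THEOREM R-CS with the validity `V_∧` — the gates made ordinary and the all-pure-`{1}` case (p6, gen 28)

Setting of `C041ZonePortCSUnport` / `C041ZonePortCSAndDefs`: the dictionary of `unport` read for the validity
`V_∧` (`validAnd_extendU_false_iff`; the all-red extension of a valid pattern is valid since `X₂` is the same on
both sides), and the count comparisons `card_notGood₂And_eq`, `card_good₁And_unport_le`, `card_good₂And_unport_le`;
hence **`csAnd_of_pure₁_gates`**.
-/

namespace PercRepro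

namespace ZonePort

namespace Problem

open Finset CSCount

variable {V E : Type*}

section Dict

variable [DecidableEq V] {P : Problem V E} {S : Finset (Finset V)}

/-- With every edge at `S` blue, the validity `V_∧` is the same on both sides of the extension. -/
theorem validAnd_extendU_false_iff (hS₁ : ∀ C ∈ S, P.Pure₁ C) (hSsw : ∀ C ∈ S, P.sw C = true)
    (x' : (P.unport S).Term → Bool) : P.ValidAnd (P.extendU S false x') ↔ (P.unport S).ValidAnd x' :=
  and_congr (adm_extendU_iff hS₁ hSsw false x') (and_congr (X₁_extendU_false_iff x') (X₂_extendU_iff hS₁ false x'))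

end Dict

section Counts

variable [Fintype E] [DecidableEq E] [DecidableEq V] {P : Problem V E} {S : Finset (Finset V)}

open Classical in
/-- The valid patterns that are not `Good₂`. -/
noncomputable def notGood₂AndSet (P : Problem V E) : Finset (P.Term → Bool) :=
  P.validAndSet.filter fun x => ¬ P.Good₂ x

/-- `#valid = #Good₂ + #(valid ∖ Good₂)`. -/
theorem card_validAndSet_eq_good₂_add : #(P.validAndSet) = #(P.good₂AndSet) + #(P.notGood₂AndSet) := by
  classical
  unfold notGood₂AndSet
  rw [good₂AndSet_eq_filter]
  exact (Finset.card_filter_add_card_filter_not _).symm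

/-- Membership in the valid patterns that are not `Good₂`. -/
theorem mem_notGood₂AndSet {x : P.Term → Bool} : x ∈ P.notGood₂AndSet ↔ P.ValidAnd x ∧ ¬ P.Good₂ x := by
  classical
  unfold notGood₂AndSet
  rw [Finset.mem_filter, mem_validAndSet]

/-- **The valid patterns that are not `Good₂` correspond** across the extension, for a set `S` of switchable
pure-`{1}` gates: `#(valid ∖ Good₂) = #(valid′ ∖ Good₂′)`. -/
theorem card_notGood₂And_eq (hSg : ∀ C ∈ S, P.IsGate C) (hS₁ : ∀ C ∈ S, P.Pure₁ C) (hSsw : ∀ C ∈ S, P.sw C = true) :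
    #(P.notGood₂AndSet) = #((P.unport S).notGood₂AndSet) := by
  refine Finset.card_nbij' (P.restrictU S) (P.extendU S false) ?_ ?_ ?_ ?_
  · intro x hx
    rw [Finset.mem_coe, mem_notGood₂AndSet] at hx
    rw [Finset.mem_coe, mem_notGood₂AndSet]
    have hx' : P.extendU S false (P.restrictU S x) = x :=
      extendU_restrictU false (blue_at_gates_of_not_good₂ hSg hS₁ hx.2)
    rw [← validAnd_extendU_false_iff hS₁ hSsw, ← good₂_extendU_false_iff hS₁, hx']
    exact hx
  · intro x' hx'
    rw [Finset.mem_coe, mem_notGood₂AndSet] at hx'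
    rw [Finset.mem_coe, mem_notGood₂AndSet, validAnd_extendU_false_iff hS₁ hSsw, good₂_extendU_false_iff hS₁]
    exact hx'
  · intro x hx
    rw [Finset.mem_coe, mem_notGood₂AndSet] at hx
    exact extendU_restrictU false (blue_at_gates_of_not_good₂ hSg hS₁ hx.2)
  · intro x' _
    exact restrictU_extendU false x'

/-- **The valid `Good₁` patterns of `P.unport S` inject into those of `P`** (the all-red extension), for a set `S`
of switchable pure-`{1}` zones carrying an edge. -/
theorem card_good₁And_unport_le (hS₁ : ∀ C ∈ S, P.Pure₁ C) (hSsw : ∀ C ∈ S, P.sw C = true) {e : P.Term}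
    (he : P.tz e.1 ∈ S) : #((P.unport S).good₁AndSet) ≤ #(P.good₁AndSet) := by
  refine Finset.card_le_card_of_injOn (P.extendU S true) ?_ ?_
  · intro x' hx'
    rw [Finset.mem_coe, mem_good₁AndSet] at hx'
    rw [Finset.mem_coe, mem_good₁AndSet]
    refine ⟨⟨(adm_extendU_iff hS₁ hSsw true x').2 hx'.1.1, X₁_extendU_true hS₁ he x',
      (X₂_extendU_iff hS₁ true x').2 hx'.1.2.2⟩, ?_⟩
    exact (good₁_extendU_true_iff hS₁ x').2 hx'.2
  · intro x' _ y' _ hxy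
    have := congrArg (P.restrictU S) hxy
    rwa [restrictU_extendU, restrictU_extendU] at this

/-- **The valid `Good₂` patterns of `P.unport S` inject into those of `P`** (the closed extension), for a set `S`
of switchable pure-`{1}` zones. -/
theorem card_good₂And_unport_le (hS₁ : ∀ C ∈ S, P.Pure₁ C) (hSsw : ∀ C ∈ S, P.sw C = true) :
    #((P.unport S).good₂AndSet) ≤ #(P.good₂AndSet) := by
  refine Finset.card_le_card_of_injOn (P.extendU S false) ?_ ?_
  · intro x' hx'
    rw [Finset.mem_coe, mem_good₂AndSet] at hx'
    rw [Finset.mem_coe, mem_good₂AndSet, validAnd_extendU_false_iff hS₁ hSsw, good₂_extendU_false_iff hS₁]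
    exact hx'
  · intro x' _ y' _ hxy
    have := congrArg (P.restrictU S) hxy
    rwa [restrictU_extendU, restrictU_extendU] at this

/-- **(CS) for `P` from (CS) for `P.unport S`**, `S` a nonempty set of switchable pure-`{1}` gates: the excess
`#valid − #Good₁ − #Good₂` does not increase and the Good counts do not decrease. -/
theorem csAnd_of_pure₁_gates (hSg : ∀ C ∈ S, P.IsGate C) (hS₁ : ∀ C ∈ S, P.Pure₁ C) (hSsw : ∀ C ∈ S, P.sw C = true)
    {e : P.Term} (he : P.tz e.1 ∈ S) (h : (P.unport S).CSAnd) : P.CSAnd := by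
  have h1 := card_validAndSet_eq_good₂_add (P := P)
  have h2 := card_validAndSet_eq_good₂_add (P := P.unport S)
  have h3 := card_notGood₂And_eq hSg hS₁ hSsw
  have h4 := card_good₁And_unport_le hS₁ hSsw he
  have h5 := card_good₂And_unport_le hS₁ hSsw
  unfold CSAnd at h ⊢
  exact cs_mono h h4 h5 (by omega)

end Counts

end Problem

end ZonePort

end PercRepro
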